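import Literature.Geometry.Riemannian.HopfRinowCompact
import Literature.Geometry.Riemannian.ExponentialMapCornerCutting
import Literature.Geometry.Riemannian.GeodesicBallMinimizing
import HarnessLib

/-!
# Hopf–Rinow on compact manifolds: discharge of `hopfRinow_compact` (Lee 2018, Cor. 6.21–6.22)

Final assembly of the proof of the named fact
`Literature.Geometry.Riemannian.hopfRinow_compact` of `ExponentialMap.lean` (J. M. Lee,
*Introduction to Riemannian Manifolds*, 2nd ed. (2018), Cor. 6.22: on a compact Riemannian
manifold every maximal geodesic is defined for all time; Cor. 6.21: any two points of a
complete connected Riemannian manifold are joined by a minimizing geodesic segment), from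

* part (i), geodesic completeness (`hopfRinow_compact_geodesicallyComplete`,
  `HopfRinowCompact.lean`, via Gordon's criterion / O'Neill 1983, Ch. 5, Cor. 23);
* the reduction of part (ii) to the local theory of `exp` (Lee, Lemma 6.18 (a);
  `exists_isMinimizingUpTo_of_local`, `HopfRinowCompact.lean`), whose two hypotheses are
* (L1) radial geodesics realise the distance near each point (Lee, Prop. 6.11, Cor. 6.12–6.13;
  `exists_riemannianExpMap_eq_of_edist_lt`, `GeodesicBallMinimizing.lean`, through the inverse
  function theorem, the Gauss lemma `GaussLemmaRiemannianExp.lean` and the radial length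
  inequality), and
* (L2) corner cutting (Lee, p. 168; `exists_edist_riemannianExpMap_lt_two_mul`,
  `ExponentialMapCornerCutting.lean`, through `d(exp_y)_0 = id`,
  `ExponentialMapDifferential.lean`).

No definitions, no named facts (D-0026).

## References

* J. M. Lee, *Introduction to Riemannian Manifolds*, 2nd ed., GTM 176 (2018): Lemma 6.18,
  Thm. 6.19, Cor. 6.21, Cor. 6.22 (pp. 166–169). [LeeRiemannianManifolds2018]
-/

noncomputable section

open Bundle Set Manifold
open scoped Manifold ContDiff Topology

namespace Literature.Geometry.Riemannian

open Literature.Geometry.Lorentzian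
open Literature.Geometry.Lorentzian.PseudoRiemannianMetric

/-- **Hopf–Rinow on compact manifolds** (Lee 2018, Cor. 6.21 and Cor. 6.22): discharge of the
named fact `hopfRinow_compact` — on a compact connected Riemannian manifold without boundary
(smooth metric) the Levi-Civita connection is geodesically complete and any two points `p, q`
are joined by a minimizing geodesic segment `γ_v|[0,1]` with `exp_p v = q`.
[cite: LeeRiemannianManifolds2018, Cor. 6.21 and Cor. 6.22] -/
theorem hopfRinow_compact_holds : hopfRinow_compact := by
  intro E _ _ _ _ H _ I M _ _ _ _ _ _ _ n hn g _ _ hg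
  haveI : Fact (1 ≤ n) := ⟨le_trans (by exact_mod_cast le_top) hn⟩
  have hc : IsGeodesicallyComplete g.leviCivita := hopfRinow_compact_geodesicallyComplete hn hg
  refine ⟨hc, exists_isMinimizingUpTo_of_local hg hc (fun y => ?_) (fun y u w hu hw huw => ?_)⟩
  · obtain ⟨δ, hδ, h⟩ := exists_riemannianExpMap_eq_of_edist_lt hn hg hc y
    exact ⟨δ, hδ, h⟩
  · exact exists_edist_riemannianExpMap_lt_two_mul hg hc y hu hw huw

end Literature.Geometry.Riemannian
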